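import Summits.AtomisticToContinuum.FouriersLaw.Theorems.OddSectorIrreversibilityOddDensityIsCorrectorDetailedBalance

/-!
# `OddDensityIsCorrector`, part 11: the key estimate `‖h - (R_λ g + λR_λ(h₁∘Θ))∘Θ‖ ≤ √8 ‖h - h₁‖`

Helper file for support item `stmt-AtomisticToContinuum-9146`
(`OddSectorIrreversibility.OddDensityIsCorrector`).

Let `h ∈ L²(μ_T)` be a weak solution of the adjoint equation `∫ (LF) h dμ_T = -∫ F g dμ_T` (all test
`F`) with an even nice source `g`, and let `h₁` be a bounded continuous function (an `L²`
approximant of `h`). For `λ > 0` put `W = R_λ g + λ R_λ (h₁∘Θ)` and `D = h - W∘Θ`. Then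

  `∫ D² dμ_T ≤ 8 ∫ (h - h₁)² dμ_T`              (`pinnedChain_key_estimate`).

Indeed for `F'' = λF - LF` one computes `∫ F'' D dμ_T = λ ∫ F (h - h₁) dμ_T` (the weak equation,
`Θ`-invariance of `μ_T`, detailed balance `pinnedChain_resolvent_detailed_balance` and `R_λ F'' = F`),
and the density of such `F''` (`exists_testFunction_resolvent_approx`) with the `L²`-bound
`λ‖R_λ F''‖ ≤ ‖F''‖` and weighted AM–GM closes the estimate (the constant `8` is immaterial).
Nothing here closes an item.
-/

noncomputable section

open MeasureTheory ProbabilityTheory Filter Topology Set Function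
open scoped ContDiff NNReal ENNReal
open Literature.MathematicalPhysics.KineticTheory.HeatConduction
open Summit.AtomisticToContinuum.FouriersLaw.Theorems.SubdiffusiveBondHeat

namespace Summit.AtomisticToContinuum.FouriersLaw.Theorems.OddSectorIrreversibility

variable {N : ℕ}

section Pinned

variable {ω₂ lam β γ : ℝ} (hω : 0 < ω₂) (hl : 0 ≤ lam) (hβ : 0 < β) (hγ : 0 < γ) (hN : 2 ≤ N)
  {T : ℝ} (hT : 0 < T)
include hω hl hβ hγ hN hT

set_option maxHeartbeats 400000 in
/-- **The key estimate.** For the pinned anharmonic chain at equilibrium (`0 < ϑ`, `2ϑ < 1/T`,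
`λ > 0`): let `h ∈ L²(μ_T)` (measurable) satisfy `∫ (LF) h dμ_T = -∫ F g dμ_T` for all test `F`, with
`g` nice and even in the momenta, and let `h₁` be continuous and bounded. Then with
`W = R_λ g + λ R_λ(h₁∘Θ)`: `∫ (h - W∘Θ)² dμ_T ≤ 8 ∫ (h - h₁)² dμ_T`. [folklore] -/
theorem pinnedChain_key_estimate {ϑ : ℝ} (hϑ0 : 0 < ϑ) (h2ϑ : 2 * ϑ < 1 / T)
    {h : PhaseSpace N → ℝ} (hhm : Measurable h) (hh : MemLp h 2 ((pinnedChain ω₂ lam β γ).gibbsMeasure N T))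
    {g : PhaseSpace N → ℝ} (hg : Continuous g) {Cg : ℝ} (hCg : 0 ≤ Cg)
    (hgb : ∀ y, |g y| ≤ Cg * Real.exp (ϑ * (pinnedChain ω₂ lam β γ).hamiltonian N y))
    (hge : ∀ y : PhaseSpace N, g (y.1, -y.2) = g y)
    (hweak : ∀ F : PhaseSpace N → ℝ, ContDiff ℝ ∞ F → HasCompactSupport F →
      ∫ x, (pinnedChain ω₂ lam β γ).generator N T T F x * h x ∂((pinnedChain ω₂ lam β γ).gibbsMeasure N T) =
        -∫ x, F x * g x ∂((pinnedChain ω₂ lam β γ).gibbsMeasure N T))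
    {h₁ : PhaseSpace N → ℝ} (hh₁ : Continuous h₁) {B₁ : ℝ} (hB₁ : ∀ y, ‖h₁ y‖ ≤ B₁)
    {lam' : ℝ} (hlam : 0 < lam') :
    ∫ z, (h z - ((∫ t in Ioi (0 : ℝ), Real.exp (-(lam' * t)) *
          ∫ y, g y ∂((pinnedChain ω₂ lam β γ).transitionKernel N T T t.toNNReal (z.1, -z.2))) +
        lam' * ∫ t in Ioi (0 : ℝ), Real.exp (-(lam' * t)) *
          ∫ y, h₁ (y.1, -y.2) ∂((pinnedChain ω₂ lam β γ).transitionKernel N T T t.toNNReal (z.1, -z.2)))) ^ 2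
        ∂((pinnedChain ω₂ lam β γ).gibbsMeasure N T) ≤
      8 * ∫ z, (h z - h₁ z) ^ 2 ∂((pinnedChain ω₂ lam β γ).gibbsMeasure N T) := by
  set P := pinnedChain ω₂ lam β γ with hP
  set π := P.gibbsMeasure N T with hπ
  have hN0 : 0 < N := by omega
  have hϑ1 : ϑ < 1 / T := by linarith
  haveI : IsProbabilityMeasure π := pinnedChain_isProbabilityMeasure_gibbsMeasure hω hl hβ.le γ N hT
  have hU1 : ContDiff ℝ 1 P.U := pinnedChain_contDiff_U ω₂ lam β γ
  have hV1 : ContDiff ℝ 1 P.V := pinnedChain_contDiff_V ω₂ lam β γ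
  set R : (PhaseSpace N → ℝ) → PhaseSpace N → ℝ := fun f z => ∫ t in Ioi (0 : ℝ), Real.exp (-(lam' * t)) *
    ∫ y, f y ∂(P.transitionKernel N T T t.toNNReal z) with hR
  have hΘc : Continuous (fun y : PhaseSpace N => ((y.1, -y.2) : PhaseSpace N)) := continuous_fst.prodMk continuous_snd.neg
  have hΘm : Measurable (fun y : PhaseSpace N => ((y.1, -y.2) : PhaseSpace N)) := measurable_fst.prodMk measurable_snd.neg
  set Θh : PhaseSpace N ≃ₜ PhaseSpace N := (Homeomorph.refl (Fin N → ℝ)).prodCongr (Homeomorph.neg (Fin N → ℝ)) with hΘh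
  have hHΘ : ∀ y : PhaseSpace N, P.hamiltonian N (y.1, -y.2) = P.hamiltonian N y :=
    fun y => OscillatorChain.hamiltonian_neg_momentum P N y
  obtain ⟨K, c, -, hc, hb⟩ := pinnedChain_harris_bound hω hl hβ hγ hN0 hT hϑ0 hϑ1
  -- nice data: `h₁∘Θ`, `B = g + λ h₁∘Θ`
  have hB₁0 : 0 ≤ B₁ := (norm_nonneg _).trans (hB₁ 0)
  set h₁Θ : PhaseSpace N → ℝ := fun y => h₁ (y.1, -y.2) with hh₁Θ
  have hh₁Θc : Continuous h₁Θ := hh₁.comp hΘc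
  have hh₁Θb : ∀ y, |h₁Θ y| ≤ B₁ * Real.exp (ϑ * P.hamiltonian N y) := fun y =>
    abs_le_exp_bound_of_bounded hω.le hl hβ.le γ hϑ0.le (fun y => hB₁ (y.1, -y.2)) y
  set B : PhaseSpace N → ℝ := fun y => g y + lam' * h₁Θ y with hBdef
  have hBc : Continuous B := hg.add (continuous_const.mul hh₁Θc)
  have hlamh : ∀ y, |lam' * h₁Θ y| ≤ (|lam'| * B₁) * Real.exp (ϑ * P.hamiltonian N y) :=
    abs_const_mul_le_exp_bound lam' hh₁Θb
  have hBb : ∀ y, |B y| ≤ (Cg + |lam'| * B₁) * Real.exp (ϑ * P.hamiltonian N y) := abs_add_le_exp_bound hgb hlamh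
  have hCB : 0 ≤ Cg + |lam'| * B₁ := by positivity
  -- `W = R B = R g + λ R(h₁Θ)`
  obtain ⟨W, hW⟩ : ∃ W : PhaseSpace N → ℝ, W = fun z => R g z + lam' * R h₁Θ z := ⟨_, rfl⟩
  have hlamhc : Continuous fun y => lam' * h₁Θ y := continuous_const.mul hh₁Θc
  have hWRB : ∀ z, R B z = W z := by
    intro z
    have h1 : R B z = R g z + R (fun y => lam' * h₁Θ y) z :=
      pinnedChain_resolvent_add hω hl hβ hγ hN0 hT hϑ0 hϑ1 hg hlamhc hCg (by positivity) hgb hlamh hlam z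
    have h2 : R (fun y => lam' * h₁Θ y) z = lam' * R h₁Θ z := pinnedChain_resolvent_const_mul lam' h₁Θ lam' z
    rw [h1, h2, hW]
  -- `L²` facts
  have hRB := pinnedChain_integral_sq_resolvent_le hω hl hβ hγ hN0 hT hϑ0 h2ϑ hBc hCB hBb hlam
  have hRBm : Measurable (R B) := (pinnedChain_stronglyMeasurable_resolvent hω hl hβ.le hγ.le T T hBc.measurable lam').measurable
  have hWm : Measurable W := by
    have : W = R B := funext fun z => (hWRB z).symm
    rw [this]; exact hRBm
  have hW2 : Integrable (fun z => W z ^ 2) π := by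
    have : (fun z => W z ^ 2) = fun z => R B z ^ 2 := funext fun z => by rw [hWRB]
    rw [this]; exact hRB.1
  have hWΘm : Measurable fun z : PhaseSpace N => W (z.1, -z.2) := hWm.comp hΘm
  have hWΘ2 : Integrable (fun z => W (z.1, -z.2) ^ 2) π := by
    have hmp := measurePreserving_reversal_gibbsMeasure P N T
    have := (hmp.integrable_comp (hWm.pow_const 2).aestronglyMeasurable).2 hW2
    simpa [Function.comp_def, momentumReversal_apply] using this
  have hh2 : Integrable (fun z => h z ^ 2) π := hh.integrable_sq
  have hh₁2 : Integrable (fun z => h₁ z ^ 2) π := integrable_sq_of_bounded hh₁ hB₁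
  obtain ⟨D, hD⟩ : ∃ D : PhaseSpace N → ℝ, D = fun z => h z - W (z.1, -z.2) := ⟨_, rfl⟩
  -- bridge to the statement's integrand
  have hgoal : (fun z => (h z - (R g (z.1, -z.2) + lam' * R h₁Θ (z.1, -z.2))) ^ 2) = fun z => D z ^ 2 := by
    funext z; simp only [hD, hW]
  rw [show (∫ z, (h z - (R g (z.1, -z.2) + lam' * R h₁Θ (z.1, -z.2))) ^ 2 ∂π) = ∫ z, D z ^ 2 ∂π from by rw [hgoal]]
  have hDm : Measurable D := by rw [hD]; exact hhm.sub hWΘm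
  have hD2 : Integrable (fun z => D z ^ 2) π :=
    ((hh2.add hWΘ2).const_mul 2).mono' (hDm.pow_const 2).aestronglyMeasurable (Eventually.of_forall fun z => by
      rw [Real.norm_eq_abs, abs_of_nonneg (sq_nonneg _), Pi.add_apply]; simp only [hD]
      nlinarith [sq_nonneg (h z + W (z.1, -z.2))])
  have hDL : MemLp D 2 π := (memLp_two_iff_integrable_sq hDm.aestronglyMeasurable).2 hD2
  have hE2 : Integrable (fun z => (h z - h₁ z) ^ 2) π :=
    ((hh2.add hh₁2).const_mul 2).mono' ((hhm.sub hh₁.measurable).pow_const 2).aestronglyMeasurable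
      (Eventually.of_forall fun z => by
        rw [Real.norm_eq_abs, abs_of_nonneg (sq_nonneg _), Pi.add_apply]; nlinarith [sq_nonneg (h z + h₁ z)])
  set d := ∫ z, D z ^ 2 ∂π with hd
  set e := ∫ z, (h z - h₁ z) ^ 2 ∂π with he
  have hd0 : 0 ≤ d := integral_nonneg fun z => sq_nonneg _
  have he0 : 0 ≤ e := integral_nonneg fun z => sq_nonneg _
  -- (B2) the pairing identity `∫ F'' D = λ ∫ F (h - h₁)` for `F'' = λF - LF`
  have hpair : ∀ F : PhaseSpace N → ℝ, ContDiff ℝ ∞ F → HasCompactSupport F →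
      ∫ z, (lam' * F z - P.generator N T T F z) * D z ∂π = lam' * ∫ z, F z * (h z - h₁ z) ∂π := by
    intro F hF hFc
    have hF2 : ContDiff ℝ 2 F := hF.of_le (by norm_cast)
    set F'' : PhaseSpace N → ℝ := fun z => lam' * F z - P.generator N T T F z with hF''
    have hLFc : Continuous (P.generator N T T F) := P.continuous_generator hU1 hV1 N T T hF2
    have hLFs : HasCompactSupport (P.generator N T T F) := P.hasCompactSupport_generator N T T hF2 hFc
    have hF''c : Continuous F'' := (continuous_const.mul hF.continuous).sub hLFc
    have hF''s : HasCompactSupport F'' := (hFc.mul_left).sub hLFs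
    obtain ⟨BF, hBF⟩ := hF''c.bounded_above_of_compact_support hF''s
    obtain ⟨BF0, hBF0⟩ := hF.continuous.bounded_above_of_compact_support hFc
    have hF''2 : Integrable (fun z => F'' z ^ 2) π := integrable_sq_of_bounded hF''c hBF
    have hF2i : Integrable (fun z => F z ^ 2) π := integrable_sq_of_bounded hF.continuous hBF0
    -- `∫ F'' h = λ ∫ F h + ∫ F g`
    have iFh : Integrable (fun z => F z * h z) π :=
      integrable_mul_of_integrable_sq hF.continuous.aestronglyMeasurable hhm.aestronglyMeasurable hF2i hh2
    have iLFh : Integrable (fun z => P.generator N T T F z * h z) π :=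
      integrable_mul_of_integrable_sq hLFc.aestronglyMeasurable hhm.aestronglyMeasurable (integrable_sq_of_bounded hLFc
        (Classical.choose_spec (hLFc.bounded_above_of_compact_support hLFs))) hh2
    have e1 : ∫ z, F'' z * h z ∂π = lam' * (∫ z, F z * h z ∂π) + ∫ z, F z * g z ∂π := by
      have : (fun z => F'' z * h z) = fun z => lam' * (F z * h z) - P.generator N T T F z * h z := by
        funext z; simp only [hF'']; ring
      rw [this, integral_sub (iFh.const_mul lam') iLFh, integral_const_mul, hweak F hF hFc]
      ring
    -- `∫ F''(z) W(Θz) = ∫ F (g + λ h₁)` via `Θ`-invariance and detailed balance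
    have hF''Θc : Continuous fun y : PhaseSpace N => F'' (y.1, -y.2) := hF''c.comp hΘc
    have hF''Θb : ∀ y : PhaseSpace N, |F'' (y.1, -y.2)| ≤ BF * Real.exp (ϑ * P.hamiltonian N y) := fun y =>
      abs_le_exp_bound_of_bounded hω.le hl hβ.le γ hϑ0.le (fun y => hBF (y.1, -y.2)) y
    have hBF' : 0 ≤ BF := (norm_nonneg _).trans (hBF 0)
    have hRF0 : ∀ z, R F'' z = F z := fun z => pinnedChain_resolvent_sub_generator hω hl hβ hγ hN0 hT hF hFc hlam z
    have e2 : ∫ z, F'' z * W (z.1, -z.2) ∂π = ∫ z, F z * (g z + lam' * h₁ z) ∂π := by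
      -- `Θ`-invariance: `∫ F''(z) W(Θz) = ∫ F''(Θz) W(z)`
      have hΘi := integral_comp_reversal_gibbsMeasure P N T (fun z => F'' z * W (z.1, -z.2))
      simp only [neg_neg, Prod.mk.eta] at hΘi
      rw [← hΘi]
      have eL : ∫ z, F'' (z.1, -z.2) * W z ∂π = ∫ z, F'' (z.1, -z.2) * R B z ∂π :=
        integral_congr_ae (Eventually.of_forall fun z => by simp only [hWRB])
      rw [eL]
      have eR : ∫ z, R F'' z * B (z.1, -z.2) ∂π = ∫ z, F z * (g z + lam' * h₁ z) ∂π :=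
        integral_congr_ae (Eventually.of_forall fun z => by
          simp only [hRF0 z, hBdef, hh₁Θ, hge, neg_neg, Prod.mk.eta])
      rw [← eR]
      -- detailed balance with `A = F''∘Θ`, `B = g + λ h₁Θ`
      have hDB := pinnedChain_resolvent_detailed_balance hω hl hβ hγ hN hT hϑ0 h2ϑ hF''Θc hBc hBF' hCB hF''Θb hBb hlam
      simpa only [hR, neg_neg, Prod.mk.eta] using hDB
    -- assemble
    have iF''h : Integrable (fun z => F'' z * h z) π :=
      integrable_mul_of_integrable_sq hF''c.aestronglyMeasurable hhm.aestronglyMeasurable hF''2 hh2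
    have iF''W : Integrable (fun z => F'' z * W (z.1, -z.2)) π :=
      integrable_mul_of_integrable_sq hF''c.aestronglyMeasurable hWΘm.aestronglyMeasurable hF''2 hWΘ2
    have iFg : Integrable (fun z => F z * g z) π :=
      (hF.continuous.mul hg).integrable_of_hasCompactSupport hFc.mul_right
    have iFh₁ : Integrable (fun z => F z * h₁ z) π :=
      (hF.continuous.mul hh₁).integrable_of_hasCompactSupport hFc.mul_right
    have eD : ∫ z, F'' z * D z ∂π = (∫ z, F'' z * h z ∂π) - ∫ z, F'' z * W (z.1, -z.2) ∂π := by
      rw [← integral_sub iF''h iF''W]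
      exact integral_congr_ae (Eventually.of_forall fun z => by simp only [hD]; ring)
    have eR : ∫ z, F z * (g z + lam' * h₁ z) ∂π = (∫ z, F z * g z ∂π) + lam' * ∫ z, F z * h₁ z ∂π := by
      rw [← integral_const_mul, ← integral_add iFg (iFh₁.const_mul lam')]
      exact integral_congr_ae (Eventually.of_forall fun z => by ring)
    have eE : ∫ z, F z * (h z - h₁ z) ∂π = (∫ z, F z * h z ∂π) - ∫ z, F z * h₁ z ∂π := by
      rw [← integral_sub iFh iFh₁]
      exact integral_congr_ae (Eventually.of_forall fun z => by ring)
    rw [eD, e1, e2, eR, eE]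
    ring
  -- (B3) density and weighted AM–GM: `d ≤ 8 e + 3 δ` for every `δ > 0`
  refine le_of_forall_pos_le_add fun δ' hδ' => ?_
  set δ := δ' / 3 with hδ
  have hδ0 : 0 < δ := by positivity
  obtain ⟨F, hF, hFc, happ⟩ := exists_testFunction_resolvent_approx hω hl hβ.le hγ hN hT hlam hDL hδ0
  have hF2 : ContDiff ℝ 2 F := hF.of_le (by norm_cast)
  set F'' : PhaseSpace N → ℝ := fun z => lam' * F z - P.generator N T T F z with hF''
  have hLFc : Continuous (P.generator N T T F) := P.continuous_generator hU1 hV1 N T T hF2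
  have hF''c : Continuous F'' := (continuous_const.mul hF.continuous).sub hLFc
  have hF''s : HasCompactSupport F'' := (hFc.mul_left).sub (P.hasCompactSupport_generator N T T hF2 hFc)
  obtain ⟨BF, hBF⟩ := hF''c.bounded_above_of_compact_support hF''s
  have hBF' : 0 ≤ BF := (norm_nonneg _).trans (hBF 0)
  have hF''b : ∀ y, |F'' y| ≤ BF * Real.exp (ϑ * P.hamiltonian N y) := abs_le_exp_bound_of_bounded hω.le hl hβ.le γ hϑ0.le hBF
  have hF''2 : Integrable (fun z => F'' z ^ 2) π := integrable_sq_of_bounded hF''c hBF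
  obtain ⟨BF0, hBF0⟩ := hF.continuous.bounded_above_of_compact_support hFc
  have hF2i : Integrable (fun z => F z ^ 2) π := integrable_sq_of_bounded hF.continuous hBF0
  -- `λ² ∫ F² ≤ ∫ F''²` (since `F = R F''`)
  have hRF : ∀ z, R F'' z = F z := fun z => pinnedChain_resolvent_sub_generator hω hl hβ hγ hN0 hT hF hFc hlam z
  have hRF'' := pinnedChain_integral_sq_resolvent_le hω hl hβ hγ hN0 hT hϑ0 h2ϑ hF''c hBF' hF''b hlam
  have hlamF : lam' ^ 2 * ∫ z, F z ^ 2 ∂π ≤ ∫ z, F'' z ^ 2 ∂π := by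
    have h1 : ∫ z, F z ^ 2 ∂π = ∫ z, R F'' z ^ 2 ∂π := integral_congr_ae (Eventually.of_forall fun z => by simp only [hRF])
    rw [h1]
    have h2 := hRF''.2
    have hl2 : 0 < lam' ^ 2 := by positivity
    calc lam' ^ 2 * ∫ z, R F'' z ^ 2 ∂π ≤ lam' ^ 2 * (lam'⁻¹ ^ 2 * ∫ z, F'' z ^ 2 ∂π) :=
          mul_le_mul_of_nonneg_left h2 hl2.le
      _ = ∫ z, F'' z ^ 2 ∂π := by field_simp
  -- `∫ F''² ≤ 2 (d + δ)`
  have happ' : ∫ z, (F'' z - D z) ^ 2 ∂π ≤ δ := by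
    have : ∫ z, (F'' z - D z) ^ 2 ∂π = ∫ z, (D z - F'' z) ^ 2 ∂π :=
      integral_congr_ae (Eventually.of_forall fun z => by ring)
    rw [this]; exact happ
  have hFD2 : Integrable (fun z => (F'' z - D z) ^ 2) π :=
    ((hF''2.add hD2).const_mul 2).mono' ((hF''c.measurable.sub hDm).pow_const 2).aestronglyMeasurable
      (Eventually.of_forall fun z => by
        rw [Real.norm_eq_abs, abs_of_nonneg (sq_nonneg _), Pi.add_apply]; nlinarith [sq_nonneg (F'' z + D z)])
  have hF''le : ∫ z, F'' z ^ 2 ∂π ≤ 2 * (d + δ) := by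
    have hpt : ∀ z, F'' z ^ 2 ≤ 2 * ((F'' z - D z) ^ 2 + D z ^ 2) := fun z => by nlinarith [sq_nonneg (F'' z - 2 * D z)]
    have iB : Integrable (fun z => 2 * ((F'' z - D z) ^ 2 + D z ^ 2)) π :=
      ((hFD2.add hD2).const_mul 2).congr (Eventually.of_forall fun z => rfl)
    calc ∫ z, F'' z ^ 2 ∂π ≤ ∫ z, 2 * ((F'' z - D z) ^ 2 + D z ^ 2) ∂π := integral_mono hF''2 iB hpt
      _ = 2 * ((∫ z, (F'' z - D z) ^ 2 ∂π) + d) := by rw [integral_const_mul, integral_add hFD2 hD2]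
      _ ≤ 2 * (d + δ) := by nlinarith
  -- the two pairings
  have iF''D : Integrable (fun z => F'' z * D z) π :=
    integrable_mul_of_integrable_sq hF''c.aestronglyMeasurable hDm.aestronglyMeasurable hF''2 hD2
  have iDD : Integrable (fun z => D z * D z) π := hD2.congr (Eventually.of_forall fun z => by ring)
  have hsplit : d = (∫ z, F'' z * D z ∂π) + ∫ z, (D z - F'' z) * D z ∂π := by
    have iX : Integrable (fun z => (D z - F'' z) * D z) π := by
      have := iDD.sub iF''D
      exact this.congr (Eventually.of_forall fun z => by simp only [Pi.sub_apply]; ring)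
    rw [← integral_add iF''D iX]
    exact integral_congr_ae (Eventually.of_forall fun z => by ring)
  -- `|∫ F'' D| = λ |∫ F (h - h₁)| ≤ (1/4)(∫ (λF)²)/2·... ` weighted AM–GM with weight `1/4` on `λF`
  have hlamF2 : Integrable (fun z => (lam' * F z) ^ 2) π := (hF2i.const_mul (lam' ^ 2)).congr
    (Eventually.of_forall fun z => by ring)
  have h1 := abs_integral_mul_le_weighted (μ := π) hlamF2 hE2 (by norm_num : (0 : ℝ) < 1 / 4)
  have hP1 : |∫ z, F'' z * D z ∂π| ≤ (d + δ) / 4 + 2 * e := by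
    rw [hpair F hF hFc]
    have : lam' * ∫ z, F z * (h z - h₁ z) ∂π = ∫ z, (lam' * F z) * (h z - h₁ z) ∂π := by
      rw [← integral_const_mul]; exact integral_congr_ae (Eventually.of_forall fun z => by ring)
    rw [this]
    have hI : ∫ z, (lam' * F z) ^ 2 ∂π = lam' ^ 2 * ∫ z, F z ^ 2 ∂π := by
      rw [← integral_const_mul]; exact integral_congr_ae (Eventually.of_forall fun z => by ring)
    rw [hI] at h1
    calc |∫ z, lam' * F z * (h z - h₁ z) ∂π| ≤ (1 / 4 * (lam' ^ 2 * ∫ z, F z ^ 2 ∂π) + (1 / 4)⁻¹ * e) / 2 := h1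
      _ ≤ (1 / 4 * (2 * (d + δ)) + (1 / 4)⁻¹ * e) / 2 := by linarith [hlamF.trans hF''le]
      _ = (d + δ) / 4 + 2 * e := by norm_num; ring
  have hDF2 : Integrable (fun z => (D z - F'' z) ^ 2) π := hFD2.congr (Eventually.of_forall fun z => by ring)
  have h2 := abs_integral_mul_le_weighted (μ := π) hDF2 hD2 one_pos
  have hP2 : |∫ z, (D z - F'' z) * D z ∂π| ≤ (δ + d) / 2 := by
    have : ∫ z, (D z - F'' z) ^ 2 ∂π ≤ δ := by
      have e' : ∫ z, (D z - F'' z) ^ 2 ∂π = ∫ z, (F'' z - D z) ^ 2 ∂π :=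
        integral_congr_ae (Eventually.of_forall fun z => by ring)
      rw [e']; exact happ'
    calc |∫ z, (D z - F'' z) * D z ∂π| ≤ (1 * ∫ z, (D z - F'' z) ^ 2 ∂π + 1⁻¹ * d) / 2 := h2
      _ ≤ (1 * δ + 1⁻¹ * d) / 2 := by gcongr
      _ = (δ + d) / 2 := by norm_num
  have hdle : d ≤ |∫ z, F'' z * D z ∂π| + |∫ z, (D z - F'' z) * D z ∂π| := by
    rw [hsplit]
    exact (le_abs_self _).trans (abs_add_le _ _)
  have : d ≤ 8 * e + 3 * δ := by nlinarith [hP1, hP2, hdle]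
  calc d ≤ 8 * e + 3 * δ := this
    _ = 8 * e + δ' := by simp only [hδ]; ring

end Pinned

end Summit.AtomisticToContinuum.FouriersLaw.Theorems.OddSectorIrreversibility

end
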